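import Summits.BirchSwinnertonDyer.BirchSwinnertonDyer.Theorems.ManinLocalTwoThreeShimuraIndexBadPrimeSieve
import Literature.NumberTheory.EllipticCurves.RootNumberAtkinLehner
import Literature.NumberTheory.EllipticCurves.BSDRootNumberLocalTablesProofs
import HarnessLib

/-!
# `5 ∣ [Λ₀(f) : Λ₁(f)]` and the Atkin–Lehner sign at `5` — ROAD δ: the `25 ∣ N` residual of E-es-224 is a LOCAL root-number law
(es g43; MEMO-es §66.8)

Route `ManinLocalTwoThree`, crux C2 `ManinOddAtFour` stmt-BirchSwinnertonDyer-22967 (helper chain; seat bsd-f2-manin-es, gen 43).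

SETTING.  `W₀/ℚ` globally minimal elliptic, `D₀` a LATTICE-OPTIMAL `X₀(N)`-datum (`Λ(L₀) = c₀Λ₀(f)`), `5 ∣ [Λ₀(f) : Λ₁(f)]`
(`¬ ShimuraIndexPrimeTo 5 D₀.f`).  ROAD β (`ShimuraFive.eleven_dvd_level_of_not_shimuraIndexPrimeTo_five`) and ROAD γ
(`ShimuraSieve.eleven_profile`, `level_profile_five_datum`) put the level in the shape `N = 5^e · 11 · ∏ pᵢ` (`e ≠ 1`, `11` simple
and split with Atkin–Lehner sign `−1`, `pᵢ ≡ −1 (mod 5)` simple non-split), and E-es-224 `ShimuraFiveOnlyAtEleven` («then `N = 11`»)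
is E-es-227 (`25 ∤ N`, beyond print) `∧` E-es-228 (squarefree part, Byeon–Kim 2014 Thm. 1.1 range)
(`ShimuraFiveResidual.shimuraFiveOnlyAtEleven_of_residuals`).

THIS FILE (unconditional tree theorems unless a NAMED FACT is displayed as a hypothesis):

* §1 **`smul_eq_self_of_not_shimuraIndexPrimeTo_five`** — THEOREM A packaged: every `σ ∈ Γ_ℚ` fixing `μ₅` fixes `W₀[5]` pointwise
  (informally `W₀[5] ≅ ℤ/5 ⊕ μ₅`); and `W₀(ℚ)` has a point of order `5` (cusp lifting).  No minimality needed.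
* §2 **`atkinLehnerEigenvalueAt_five_ne_neg_one`** — THE SIGN AT `5` IS `+1`: if moreover `5 ∣ N` then `λ₅(f) ≠ −1` (THEOREM AL
  `atkinLehnerShimuraSignLaw_holds`: exactly one prime of the level has sign `−1`, and `eleven_profile` says it is `11`).
* §3 **`localRootNumberAt_five_ne_neg_one`** — modulo the two NAMED FACTS displayed verbatim as hypotheses, Carayol's
  `IsNewformOf.level_eq_conductorNorm` (`N = N_{W₀}`) and Kellock–Dokchitser/Deligne `W₀.atkinLehnerEigenvalueAt_eq_localRootNumberAt`
  (`λ_p(f) = w_p(E)`), Rohrlich's local root number of `W₀` at `5` is `≠ −1`.  By the tree's DEFINITION of `localRootNumber`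
  (Rohrlich 1993 Prop. 2 case list) this says: IF `25 ∣ N` (additive at `5`) then `W₀` is potentially multiplicative at `5` or
  potentially good with semistability defect `e ∈ {2, 6}` — the cases `e = 3` (`w₅ = (−3|5) = −1`) and `e = 4` (`w₅ = (−2|5) = −1`)
  are EXCLUDED.
* §4 **`not_twentyfive_dvd_of_splitFiveTorsionRootNumberLaw`** — hence E-es-227 `ShimuraFiveNoTwentyFive` for `W₀, D₀` follows from
  the two named facts and the LOCAL LAW L5 (cell row E-es-235 `SplitFiveTorsionRootNumberLaw`, displayed as hypothesis `hL5`):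
  «an elliptic `W/ℚ` with a rational point of order `5`, with `W[5]` fixed by `Gal(ℚ̄/ℚ(μ₅))`, and additive at `5`, has
  `w₅(W) = −1`».  WHY L5 SHOULD HOLD (paper proof, MEMO-es §66.8; not formalised): `W[5]|_{I₅} ≅ 1 ⊕ θ₄` (tame of order 4) excludes
  potentially multiplicative reduction (a ramified quadratic twist of a Tate curve has `I₅`-characters `{θ₄², θ₄³}`), excludes
  `e = 2` (the twist by the ramified quadratic character is good at `5` with `I₅`-characters `{θ₄², θ₄³}`: neither ordinary `{θ₄, 1}`
  nor supersingular = irreducible, Serre 1972 Prop. 11–12) and excludes `e = 6` (good reduction over `K₆ = ℚ₅^{nr}(5^{1/6})` is the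
  supersingular `j = 0` curve, whose height-2 formal group forces an inertia image of order `≥ 4` or wild on `W[5]`, against
  `θ₄|_{I_{K₆}} = θ'²` of order 2); the surviving `e ∈ {3, 4}` have `w₅ = −1` (Rohrlich).  CENSUS (BC5 witness of L5): on the
  `5Cs.1.1` family `E'_s = E_{s⁵}/⟨(0,0)⟩` (Tate normal form; `s = 1, 2, 3, −2, 3/2, −3, 1/4` are `11a1, 1342c2, 33825be2, 550k2,
  165066d2, 185163a2, 192698c2` = all `5Cs.1.1` curves of conductor `< 350000`), `s = u/v`, `|u|, v ≤ 40` (1958 parameters):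
  additive at `5` ⟺ `s ≡ 3 (mod 5)` (318 cases), and ALL 318 are Kodaira `III` (`v₅(Δ_min) = 3`, `e = 4`, `w₅ = −1`) —
  `HOME/es/g43/L5-family-check-g43.txt`.
HONEST FRAMING: §1–§2 unconditional; §3–§4 conditional exactly on the displayed hypotheses; L5 is a cell CONJECTURE (row E-es-235),
not a Literature fact.  C2, C3, Manin's `c = ±1` conjecture and BSD are NOT proved here.
[cite: Rohrlich1993Compositio, Prop. 2] [cite: KellockDokchitser2023, Rem. 2.2] [cite: Carayol1986] [cite: LingOesterle1991, Thm. 6]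
[cite: AtkinLehner1970, Thm. 3] [cite: Vatsal2005, Rem. 1.8] [cite: Serre1972, Prop. 11, Prop. 12] [cite: ByeonKim2014, Thm. 1.1]
-/

set_option linter.dupNamespace false
set_option autoImplicit false

noncomputable section

open scoped Classical MatrixGroups ModularForm PeriodPair

open CongruenceSubgroup WeierstrassCurve Field Polynomial NumberField IsDedekindDomain IsDedekindDomain.HeightOneSpectrum
  Literature.NumberTheory.EllipticCurves
  Literature.NumberTheory.EllipticCurves.ModularForms Summit.BirchSwinnertonDyer.Rank1Residual
  Summit.BirchSwinnertonDyer.Rank1Residual.ManinAdditive Summit.BirchSwinnertonDyer.Rank1Residual.ManinAdditive.KatoCurve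
  Summit.BirchSwinnertonDyer.Rank1Residual.ManinAdditive.ShimuraCover
  Summit.BirchSwinnertonDyer.BirchSwinnertonDyer.Theorems.ManinLocalTwoThree
  Summit.BirchSwinnertonDyer.BirchSwinnertonDyer.Theorems.ManinLocalTwoThree.CuspGalois
  Summit.BirchSwinnertonDyer.BirchSwinnertonDyer.Theorems.ManinLocalTwoThree.ShimuraCoverHolds

namespace Summit.BirchSwinnertonDyer.BirchSwinnertonDyer.Theorems.ManinLocalTwoThree.ShimuraFive

/-! ### §1. THEOREM A packaged: `5 ∣ [Λ₀(f) : Λ₁(f)]` gives `W₀[5] ≅ ℤ/5 ⊕ μ₅` -/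

/-- **THEOREM A, packaged.**  For a lattice-optimal `X₀(N)`-datum of an elliptic `W₀/ℚ` with `5 ∣ [Λ₀(f) : Λ₁(f)]`, every `σ ∈ Γ_ℚ`
fixing the fifth roots of unity acts trivially on `W₀[5]` (the flat Stevens twin, F★ and cusp lifting are tree theorems).
[cite: Vatsal2005, Rem. 1.8] [cite: Stevens1989, §2] -/
theorem smul_eq_self_of_not_shimuraIndexPrimeTo_five
    (W₀ : WeierstrassCurve ℚ) [W₀.IsElliptic] {N : ℕ} [NeZero N] (D₀ : ModularParametrizationData W₀ N)
    (hopt : ∀ z ∈ D₀.L.lattice, ∃ w ∈ periodLattice D₀.f, z = D₀.c * w) (hS : ¬ ShimuraIndexPrimeTo 5 D₀.f)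
    (σ : Field.absoluteGaloisGroup ℚ) (hσ : ∀ ζ : AlgebraicClosure ℚ, ζ ^ 5 = 1 → σ • ζ = ζ) (T : W₀.geomTorsion 5) :
    σ • T = T := by
  have h5 : Nat.Prime 5 := by norm_num
  have hS' := hS
  simp only [ShimuraIndexPrimeTo, not_forall, exists_prop] at hS'
  obtain ⟨x, hx, h5x, hx₁⟩ := hS'
  obtain ⟨W₁, hW₁, D₁, hf, -, hopt₁, -, -⟩ := CuspValues.exists_optimal_gamma1ParametrizationData_flat_of_datum D₀
  haveI := hW₁
  have hF := CuspValues.optimalGamma1Parametrization_cusp_rational_holds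
  have hrat : ∀ y ∈ periodLattice D₀.f, ∃ P : (W₁.baseChange ℚ).toAffine.Point,
      Affine.Point.baseChange (W' := W₁) ℚ ℂ P = D₁.uniformize ((D₁.c : ℂ) * y) := fun y hy ↦
    exists_rational_eq_uniformize_of_mem_periodLattice hF D₁ hopt₁ (by rwa [hf])
  have hx' : x ∈ periodLattice D₁.f := by rwa [hf]
  have h5x' : ((5 : ℕ) : ℂ) * x ∈ periodLatticeGamma1 D₁.f := by rw [hf]; exact_mod_cast h5x
  have hx₁' : x ∉ periodLatticeGamma1 D₁.f := by rwa [hf]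
  obtain ⟨P, hP, hP5⟩ := exists_addOrderOf_eq_of_mem_periodLattice hF D₁ hopt₁ h5 hx' h5x' hx₁'
  obtain ⟨t, ht⟩ := CuspLifting.exists_addOrderOf_eq_prime D₀ hopt h5 hS
  exact smul_eq_self_of_shimuraCover W₀ W₁ D₀ D₁ hf hopt hopt₁ hrat h5 (by norm_num) hx hP hP5 (t := t) ht σ hσ T

/-! ### §2. The Atkin–Lehner sign at `5` is `+1` -/

/-- **The sign at `5` is not `−1`.**  For a lattice-optimal `X₀(N)`-datum of a minimal `W₀/ℚ` with `5 ∣ [Λ₀(f) : Λ₁(f)]` and `5 ∣ N`: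
`λ₅(f) ≠ −1` — the unique prime of the level with Atkin–Lehner sign `−1` (THEOREM AL) is `11` (`ShimuraSieve.eleven_profile`).
[cite: LingOesterle1991, Thm. 6] [cite: AtkinLehner1970, Thm. 3] [cite: Vatsal2005, Rem. 1.8] -/
theorem atkinLehnerEigenvalueAt_five_ne_neg_one
    (W₀ : WeierstrassCurve ℚ) [W₀.IsElliptic] [W₀.IsGloballyMinimal] {N : ℕ} [NeZero N] (D₀ : ModularParametrizationData W₀ N)
    (hopt : ∀ z ∈ D₀.L.lattice, ∃ w ∈ periodLattice D₀.f, z = D₀.c * w) (hS : ¬ ShimuraIndexPrimeTo 5 D₀.f) (h5N : 5 ∣ N) :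
    atkinLehnerEigenvalueAt D₀.f 5 ≠ -1 := by
  intro hε5
  have hf : IsNewform0 D₀.f := D₀.isNewformOf.1
  obtain ⟨h11, -, -, hε11⟩ := ShimuraSieve.eleven_profile W₀ D₀ hopt hS
  obtain ⟨q₀, -, huniq⟩ := atkinLehnerShimuraSignLaw_holds N D₀.f hf 5 (by norm_num) (by norm_num) hS
  have h1 : (5 : ℕ) = q₀ := huniq 5 ⟨by norm_num, h5N, hε5⟩
  have h2 : (11 : ℕ) = q₀ := huniq 11 ⟨by norm_num, h11, hε11⟩
  omega

/-! ### §3. Rohrlich's local root number at `5` is not `−1` (modulo Carayol and `λ_p = w_p`) -/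

/-- The place of `ℤ` under `5`. -/
private theorem natGenerator_five :
    Rat.HeightOneSpectrum.natGenerator ((Rat.HeightOneSpectrum.primesEquiv (R := ℤ)).symm ⟨5, by norm_num⟩) = 5 :=
  congrArg (fun q : Nat.Primes ↦ (q : ℕ))
    ((Rat.HeightOneSpectrum.primesEquiv (R := ℤ)).apply_symm_apply (⟨5, by norm_num⟩ : Nat.Primes))

/-- **`w₅(W₀) ≠ −1`.**  For a lattice-optimal `X₀(N)`-datum of a minimal `W₀/ℚ` with `5 ∣ [Λ₀(f) : Λ₁(f)]` and `5 ∣ N`, modulo the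
NAMED FACTS `IsNewformOf.level_eq_conductorNorm` (Carayol 1986: `N = N_{W₀}`) and `W₀.atkinLehnerEigenvalueAt_eq_localRootNumberAt`
(Kellock–Dokchitser 2023 Rem. 2.2 / Deligne: `λ_p(f) = w_p(W₀)`), both displayed verbatim as hypotheses: Rohrlich's local root number
of `W₀` at the place `5` is not `−1`.  Reading through the tree's definition `WeierstrassCurve.localRootNumber` (Rohrlich 1993, Prop. 2):
if `W₀` is additive at `5` it is potentially multiplicative or potentially good with `e ∈ {2, 6}` there (`e = 3, 4` give `−1`).
[cite: Rohrlich1993Compositio, Prop. 2] [cite: KellockDokchitser2023, Rem. 2.2] [cite: Carayol1986] [cite: LingOesterle1991, Thm. 6] -/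
theorem localRootNumberAt_five_ne_neg_one
    (W₀ : WeierstrassCurve ℚ) [W₀.IsElliptic] [W₀.IsGloballyMinimal] {N : ℕ} [NeZero N] (D₀ : ModularParametrizationData W₀ N)
    (hopt : ∀ z ∈ D₀.L.lattice, ∃ w ∈ periodLattice D₀.f, z = D₀.c * w) (hS : ¬ ShimuraIndexPrimeTo 5 D₀.f)
    (hC : IsNewformOf.level_eq_conductorNorm (N := N)) (hF1 : W₀.atkinLehnerEigenvalueAt_eq_localRootNumberAt) (h5N : 5 ∣ N) :
    W₀.localRootNumberAt ((Rat.HeightOneSpectrum.primesEquiv (R := ℤ)).symm ⟨5, by norm_num⟩) ≠ -1 := by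
  have hε := atkinLehnerEigenvalueAt_five_ne_neg_one W₀ D₀ hopt hS h5N
  have hN : N = W₀.conductorNorm ℤ := hC D₀.isNewformOf
  subst hN
  set P : Nat.Primes := ⟨5, by norm_num⟩ with hP
  have h23 : W₀.HasAdditiveReductionAt ((Rat.HeightOneSpectrum.primesEquiv (R := ℤ)).symm P) →
      3 < ringChar (ℤ ⧸ ((Rat.HeightOneSpectrum.primesEquiv (R := ℤ)).symm P).asIdeal) := fun _ ↦ by
    rw [Rat.ringChar_int_quotient_asIdeal, natGenerator_five]; omega
  have hl : atkinLehnerEigenvalueAt D₀.f (P : ℕ) =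
      (W₀.localRootNumberAt ((Rat.HeightOneSpectrum.primesEquiv (R := ℤ)).symm P) : ℂ) := hF1 D₀.isNewformOf P h5N h23
  intro hw
  apply hε
  change atkinLehnerEigenvalueAt D₀.f (P : ℕ) = -1
  rw [hl, hw]
  push_cast
  rfl

/-! ### §4. E-es-227 `ShimuraFiveNoTwentyFive` from the local law L5 -/

/-- **`25 ∤ N` from the local law L5.**  For a lattice-optimal `X₀(N)`-datum of a minimal `W₀/ℚ` with `5 ∣ [Λ₀(f) : Λ₁(f)]`, modulo
Carayol (`hC`), `λ_p = w_p` (`hF1`) and the LOCAL LAW L5 for `W₀` (`hL5`, cell row E-es-235: a rational `5`-torsion point + `W₀[5]` fixed by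
`Gal(ℚ̄/ℚ(μ₅))` + additive at `5` ⟹ `w₅ = −1`): `25 ∤ N`.  With E-es-228 this is E-es-224 (`N = 11`).
[cite: Rohrlich1993Compositio, Prop. 2] [cite: KellockDokchitser2023, Rem. 2.2] [cite: Carayol1986] [cite: Serre1972, Prop. 11, Prop. 12]
[cite: Vatsal2005, Rem. 1.8] [cite: ByeonKim2014, Thm. 1.1] -/
theorem not_twentyfive_dvd_of_splitFiveTorsionRootNumberLaw
    (W₀ : WeierstrassCurve ℚ) [W₀.IsElliptic] [W₀.IsGloballyMinimal] {N : ℕ} [NeZero N] (D₀ : ModularParametrizationData W₀ N)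
    (hopt : ∀ z ∈ D₀.L.lattice, ∃ w ∈ periodLattice D₀.f, z = D₀.c * w) (hS : ¬ ShimuraIndexPrimeTo 5 D₀.f)
    (hC : IsNewformOf.level_eq_conductorNorm (N := N)) (hF1 : W₀.atkinLehnerEigenvalueAt_eq_localRootNumberAt)
    (hL5 : (∃ t : W₀.toAffine.Point, addOrderOf t = 5) →
      (∀ σ : Field.absoluteGaloisGroup ℚ, (∀ ζ : AlgebraicClosure ℚ, ζ ^ 5 = 1 → σ • ζ = ζ) →
        ∀ T : W₀.geomTorsion 5, σ • T = T) →
      W₀.HasAdditiveReductionAt ((Rat.HeightOneSpectrum.primesEquiv (R := ℤ)).symm ⟨5, by norm_num⟩) →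
      W₀.localRootNumberAt ((Rat.HeightOneSpectrum.primesEquiv (R := ℤ)).symm ⟨5, by norm_num⟩) = -1) :
    ¬ 25 ∣ N := by
  intro h25
  have h5N : 5 ∣ N := dvd_trans ⟨5, by norm_num⟩ h25
  have hw := localRootNumberAt_five_ne_neg_one W₀ D₀ hopt hS hC hF1 h5N
  have hadd : W₀.HasAdditiveReductionAt ((Rat.HeightOneSpectrum.primesEquiv (R := ℤ)).symm ⟨5, by norm_num⟩) := by
    rw [← natGenerator_sq_dvd_conductorNorm_iff, natGenerator_five, ← hC D₀.isNewformOf]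
    simpa using h25
  exact hw (hL5 (CuspLifting.exists_addOrderOf_eq_prime D₀ hopt (by norm_num) hS)
    (smul_eq_self_of_not_shimuraIndexPrimeTo_five W₀ D₀ hopt hS) hadd)

end Summit.BirchSwinnertonDyer.BirchSwinnertonDyer.Theorems.ManinLocalTwoThree.ShimuraFive

end
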